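import Literature.NumberTheory.EllipticCurves.EisensteinSeriesNebentypusLevelRaised
import HarnessLib

/-!
# Level raising `F = E - E(M·)` of a form with nebentypus: slash law, `q`-expansion, all cusps

Topic `Literature/NumberTheory/EllipticCurves`; namespace
`Literature.NumberTheory.EllipticCurves.ModularForms`.  THEOREMS ONLY (no definition, no named
fact): the constructions of `EisensteinSeriesNebentypusCusps` (constant terms of `E ∣ α_M ∣ γ`,
Billerey–Menares Prop. 4 / Cor. 5) and `EisensteinSeriesNebentypusLevelRaised` (the level-raised
form `F₂ = E - M^{1-k}(E ∣_k α_M) = E - E(M·)` on `Γ₁(NM)`, its nebentypus, `q`-expansion and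
constant terms) for an ABSTRACT modular form `E ∈ M_k(Γ₁(N))` of nebentypus `χ` whose constant
terms at all cusps are known — `E ∣_k γ → A χ(d) [N ∣ c]` for `γ = (a b; c d) ∈ SL₂(ℤ)` (the shape
of Billerey–Menares Prop. 4 for `E_k^{𝟙,χ}`, `χ` primitive, any `k ≥ 2`).  This is the input
format in which the weight-`2` series `E_2^{𝟙,χ}` enters the proof of Billerey–Menares Thm. 2
(`EisensteinNewformLevelRaisingReductionProofs`).

* `tendsto_slash_diagGL_slash_atImInfty_of_dvd'` / `_of_isCoprime'` — constant term of
  `(E ∣_k α_M) ∣_k γ`: `M^{k-1} A χ(d) [N ∣ c]` if `M ∣ c`, `M⁻¹ χ̄(M) A χ(d) [N ∣ c]` if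
  `gcd(c, M) = 1` (Cor. 5 with `r = M`, resp. `r = 1`).
* `tendsto_levelRaise_slash_atImInfty_of_dvd'` / `_of_isCoprime'` — constant terms of
  `F = E - M^{1-k}(E ∣_k α_M)`: `0`, resp. `A χ(d)(1 - χ̄(M)M^{-k}) [N ∣ c]`.
* `levelRaise_slash_of_mem_gamma0` — `F ∣_k γ = χ(d) F` on `Γ₀(NM)`.
* `exists_levelRaised_modularForm` — `F` is (the coercion of) a modular form on `Γ₁(NM)` with
  `a_n(F) = a_n(E) - [M ∣ n] a_{n/M}(E)`.
* `exists_tendsto_levelRaise_slash_valuation_lt_one` — if `A` is `ι`-integral and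
  `χ(M)M^k ≡ 1 (mod 𝔪)` (`M` prime `≠ p`, `gcd(M, N) = 1`), all constant terms of `F` are `≡ 0`.

## References

* N. Billerey, R. Menares, *Strong modularity of reducible Galois representations*, Trans. AMS
  370 (2018), Prop. 4, Cor. 5, §3.2. [BillereyMenares2018]
* F. Diamond, J. Shurman, *A First Course in Modular Forms*, GTM 228, §5.6–5.7. [DiamondShurman2005]
-/

noncomputable section

open Complex UpperHalfPlane Filter Finset ModularForm CongruenceSubgroup Matrix

open scoped Real NNReal MatrixGroups Topology

namespace Literature.NumberTheory.EllipticCurves.ModularForms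

/-! ### Constant terms of `(E ∣_k α_M) ∣_k γ` -/

section Degeneracy

variable {N : ℕ} {k : ℤ} (χ : DirichletCharacter ℂ N) (M : ℕ) [NeZero M]

/-- **Constant term of `(E ∣_k α_M) ∣_k γ` at `i∞` when `M ∣ c`** (`gcd(M, N) = 1`): if the
constant terms of `E` are `A χ(d) [N ∣ c]`, that of `(E ∣_k α_M) ∣_k γ` is `M^{k-1} A χ(d) [N ∣ c]`
— since `α_M γ = γ' α_M` with `γ' = (a, Mb; c/M, d)` (Billerey–Menares Cor. 5, case `r = M`,
`χ₁ = 𝟙`). [cite: BillereyMenares2018, Prop. 4 and Cor. 5] -/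
theorem tendsto_slash_diagGL_slash_atImInfty_of_dvd' {E : ℍ → ℂ} {A : ℂ}
    (hE : ∀ γ : SL(2, ℤ), Tendsto (E ∣[k] γ) atImInfty
      (𝓝 (if ((γ 1 0 : ℤ) : ZMod N) = 0 then A * χ ((γ 1 1 : ℤ) : ZMod N) else 0)))
    (hMN : M.Coprime N) {γ : SL(2, ℤ)} (hγ : (M : ℤ) ∣ γ 1 0) :
    Tendsto ((E ∣[k] (glCast ((diagGL (M : ℚ) 1
        (Nat.cast_pos.mpr (NeZero.pos M)) one_pos : GL(2, ℚ)⁺) : GL (Fin 2) ℚ))) ∣[k] γ)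
      atImInfty
      (𝓝 ((M : ℂ) ^ (k - 1) * (if ((γ 1 0 : ℤ) : ZMod N) = 0 then
        A * χ ((γ 1 1 : ℤ) : ZMod N) else 0))) := by
  obtain ⟨c₁, hc₁⟩ := hγ
  have hdet : (!![γ 0 0, γ 0 1; (M : ℤ) * c₁, γ 1 1]).det = 1 := by
    rw [← hc₁, Matrix.det_fin_two_of]
    have := Matrix.SpecialLinearGroup.det_coe γ
    rw [Matrix.det_fin_two] at this
    linear_combination this
  have hdet' : (!![γ 0 0, (M : ℤ) * γ 0 1; c₁, γ 1 1]).det = 1 := by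
    rw [Matrix.det_fin_two_of] at hdet ⊢
    linear_combination hdet
  have hγeq : γ = (⟨!![γ 0 0, γ 0 1; (M : ℤ) * c₁, γ 1 1], hdet⟩ : SL(2, ℤ)) := by
    ext i j
    fin_cases i <;> fin_cases j <;> simp [hc₁]
  set γ' : SL(2, ℤ) := ⟨!![γ 0 0, (M : ℤ) * γ 0 1; c₁, γ 1 1], hdet'⟩ with hγ'
  have hprod := glCast_diagGL_mul_mapGL_of_dvd M (γ 0 0) (γ 0 1) c₁ (γ 1 1) hdet hdet'
  rw [← hγeq] at hprod
  -- `(E ∣ α_M) ∣ γ = (E ∣ γ') ∣ α_M`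
  have hslash : (E ∣[k] (glCast ((diagGL (M : ℚ) 1
      (Nat.cast_pos.mpr (NeZero.pos M)) one_pos : GL(2, ℚ)⁺) : GL (Fin 2) ℚ))) ∣[k] γ =
      (E ∣[k] γ') ∣[k] (glCast ((diagGL (M : ℚ) 1
        (Nat.cast_pos.mpr (NeZero.pos M)) one_pos : GL(2, ℚ)⁺) : GL (Fin 2) ℚ)) := by
    rw [ModularForm.SL_slash, ModularForm.SL_slash, ← SlashAction.slash_mul,
      ← SlashAction.slash_mul]
    congr 1
  rw [hslash]
  have hlim := hE γ'
  have h10 : (glCast ((diagGL (M : ℚ) 1 (Nat.cast_pos.mpr (NeZero.pos M)) one_pos :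
      GL(2, ℚ)⁺) : GL (Fin 2) ℚ)) 1 0 = 0 := by simp [glCast, diagGL]
  have h := tendsto_slash_atImInfty_of_upperTriangular (k := k) h10 (det_glCast_pos _) hlim
  convert h using 2
  have hdetM : (((glCast ((diagGL (M : ℚ) 1 (Nat.cast_pos.mpr (NeZero.pos M)) one_pos :
      GL(2, ℚ)⁺) : GL (Fin 2) ℚ)).det.val : ℝ) : ℂ) = M := by
    simp [glCast, Matrix.GeneralLinearGroup.map_det, diagGL, Matrix.det_fin_two]
  have h11 : (((glCast ((diagGL (M : ℚ) 1 (Nat.cast_pos.mpr (NeZero.pos M)) one_pos :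
      GL(2, ℚ)⁺) : GL (Fin 2) ℚ)) 1 1 : ℝ) : ℂ) = 1 := by simp [glCast, diagGL]
  rw [hdetM, h11, _root_.one_zpow, mul_one]
  -- the conditions `N ∣ c₁` and `N ∣ M c₁` agree, and the `d`-entries agree
  have h10' : (γ' 1 0 : ℤ) = c₁ := by simp [hγ']
  have h11' : (γ' 1 1 : ℤ) = γ 1 1 := by simp [hγ']
  have hcond : (((γ' 1 0 : ℤ) : ZMod N) = 0) ↔ (((γ 1 0 : ℤ) : ZMod N) = 0) := by
    have hu : IsUnit ((M : ZMod N)) := (ZMod.isUnit_iff_coprime M N).2 hMN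
    rw [h10', hc₁, Int.cast_mul, Int.cast_natCast]
    exact hu.mul_right_eq_zero.symm
  simp only [h11', hcond]
  ring

/-- **Constant term of `(E ∣_k α_M) ∣_k γ` at `i∞` when `gcd(c, M) = 1`** (`gcd(M, N) = 1`): if the
constant terms of `E` are `A χ(d) [N ∣ c]`, that of `(E ∣_k α_M) ∣_k γ` is
`M⁻¹ χ̄(M) A χ(d) [N ∣ c]` — since `α_M γ = γ' diag(1,M) T^t` with `γ' = (Ma, *; c, s)`,
`sM ≡ d (mod N)`, and `diag(1, M)` contributes `M^{k-1} M^{-k}` (Billerey–Menares Cor. 5, case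
`r = 1`, `χ₁ = 𝟙`). [cite: BillereyMenares2018, Prop. 4 and Cor. 5] -/
theorem tendsto_slash_diagGL_slash_atImInfty_of_isCoprime' {E : ℍ → ℂ} {A : ℂ}
    (hE : ∀ γ : SL(2, ℤ), Tendsto (E ∣[k] γ) atImInfty
      (𝓝 (if ((γ 1 0 : ℤ) : ZMod N) = 0 then A * χ ((γ 1 1 : ℤ) : ZMod N) else 0)))
    (hMN : M.Coprime N) {γ : SL(2, ℤ)} (hγ : IsCoprime (γ 1 0) M) :
    Tendsto ((E ∣[k] (glCast ((diagGL (M : ℚ) 1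
        (Nat.cast_pos.mpr (NeZero.pos M)) one_pos : GL(2, ℚ)⁺) : GL (Fin 2) ℚ))) ∣[k] γ)
      atImInfty
      (𝓝 ((M : ℂ)⁻¹ * (if ((γ 1 0 : ℤ) : ZMod N) = 0 then
        χ⁻¹ (M : ZMod N) * (A * χ ((γ 1 1 : ℤ) : ZMod N)) else 0))) := by
  obtain ⟨x, y, hxy⟩ := hγ
  have hdetγ : (!![γ 0 0, γ 0 1; γ 1 0, γ 1 1]).det = 1 := by
    rw [Matrix.det_fin_two_of]
    have := Matrix.SpecialLinearGroup.det_coe γ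
    rw [Matrix.det_fin_two] at this
    exact this
  have hγeq : γ = (⟨!![γ 0 0, γ 0 1; γ 1 0, γ 1 1], hdetγ⟩ : SL(2, ℤ)) := by
    ext i j
    fin_cases i <;> fin_cases j <;> simp
  have hdet' : (!![(M : ℤ) * γ 0 0, γ 0 1 - γ 0 0 * (x * γ 1 1); γ 1 0, γ 1 1 * y]).det = 1 := by
    rw [Matrix.det_fin_two_of] at hdetγ ⊢
    linear_combination (γ 0 0 * γ 1 1) * hxy + hdetγ
  have hT : (!![(1 : ℤ), x * γ 1 1; 0, 1]).det = 1 := by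
    rw [Matrix.det_fin_two_of]; ring
  set γ' : SL(2, ℤ) := ⟨!![(M : ℤ) * γ 0 0, γ 0 1 - γ 0 0 * (x * γ 1 1); γ 1 0, γ 1 1 * y], hdet'⟩
    with hγ'
  set T' : SL(2, ℤ) := ⟨!![(1 : ℤ), x * γ 1 1; 0, 1], hT⟩ with hT'
  have hprod := glCast_diagGL_mul_mapGL_of_isCoprime M (γ 0 0) (γ 0 1) (γ 1 0) (γ 1 1) x y
    hdetγ hxy hdet' hT
  rw [← hγeq] at hprod
  -- `(E ∣ α_M) ∣ γ = ((E ∣ γ') ∣ diag(1, M)) ∣ T'`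
  have hslash : (E ∣[k] (glCast ((diagGL (M : ℚ) 1
      (Nat.cast_pos.mpr (NeZero.pos M)) one_pos : GL(2, ℚ)⁺) : GL (Fin 2) ℚ))) ∣[k] γ =
      ((E ∣[k] γ') ∣[k] (glCast ((diagGL 1 (M : ℚ) one_pos
        (Nat.cast_pos.mpr (NeZero.pos M)) : GL(2, ℚ)⁺) : GL (Fin 2) ℚ))) ∣[k] T' := by
    rw [ModularForm.SL_slash, ModularForm.SL_slash, ModularForm.SL_slash,
      ← SlashAction.slash_mul, ← SlashAction.slash_mul, ← SlashAction.slash_mul]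
    congr 1
    rw [mul_assoc] at hprod
    exact hprod
  rw [hslash]
  have hlim := hE γ'
  have h10 : (glCast ((diagGL 1 (M : ℚ) one_pos (Nat.cast_pos.mpr (NeZero.pos M)) :
      GL(2, ℚ)⁺) : GL (Fin 2) ℚ)) 1 0 = 0 := by simp [glCast, diagGL]
  have h := tendsto_slash_atImInfty_of_upperTriangular (k := k) h10 (det_glCast_pos _) hlim
  have hT10 : T' 1 0 = 0 := by simp [hT']
  have hT11 : T' 1 1 = 1 := by simp [hT']
  have h2 := tendsto_slash_SL2_atImInfty_of_upperTriangular (k := k) hT10 hT11 h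
  convert h2 using 2
  have hdetM : (((glCast ((diagGL 1 (M : ℚ) one_pos (Nat.cast_pos.mpr (NeZero.pos M)) :
      GL(2, ℚ)⁺) : GL (Fin 2) ℚ)).det.val : ℝ) : ℂ) = M := by
    simp [glCast, Matrix.GeneralLinearGroup.map_det, diagGL, Matrix.det_fin_two]
  have h11 : (((glCast ((diagGL 1 (M : ℚ) one_pos (Nat.cast_pos.mpr (NeZero.pos M)) :
      GL(2, ℚ)⁺) : GL (Fin 2) ℚ)) 1 1 : ℝ) : ℂ) = M := by simp [glCast, diagGL]
  have hM0 : (M : ℂ) ≠ 0 := by exact_mod_cast NeZero.ne M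
  rw [hdetM, h11]
  -- the lower rows: `γ' 1 0 = c`, `γ' 1 1 = d y` with `M (d y) ≡ d (mod N)` when `N ∣ c`
  have hc' : (γ' 1 0 : ℤ) = γ 1 0 := by simp [hγ']
  have hd' : (γ' 1 1 : ℤ) = γ 1 1 * y := by simp [hγ']
  rw [hc', hd', Int.cast_mul]
  split_ifs with hc
  · have hu : IsUnit ((M : ZMod N)) := (ZMod.isUnit_iff_coprime M N).2 hMN
    -- from `x c + y M = 1` and `c ≡ 0`: `y M = 1` in `ℤ/N`
    have hyM : (y : ZMod N) * (M : ZMod N) = 1 := by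
      have := congrArg ((↑) : ℤ → ZMod N) hxy
      push_cast at this
      rw [hc, mul_zero, zero_add] at this
      exact this
    have hχy : χ (y : ZMod N) = χ⁻¹ (M : ZMod N) := by
      rw [MulChar.inv_apply_eq_inv']
      refine (eq_inv_of_mul_eq_one_left ?_)
      rw [← map_mul, hyM, map_one]
    rw [map_mul, hχy]
    have hk1 : (M : ℂ) ^ (k - 1) * (M : ℂ) ^ (-k) = (M : ℂ)⁻¹ := by
      rw [← zpow_add₀ hM0, show k - 1 + -k = -1 by ring, _root_.zpow_neg_one]
    calc _ = (M : ℂ) ^ (k - 1) * (M : ℂ) ^ (-k) *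
          (χ⁻¹ (M : ZMod N) * (A * χ ((γ 1 1 : ℤ) : ZMod N))) := by
          rw [hk1]
      _ = _ := by ring
  · simp

end Degeneracy

/-! ### The level-raising combination `F = E - M^{1-k} (E ∣_k α_M) = E - E(M·)` -/

section LevelRaise

variable {N : ℕ} {k : ℤ} (χ : DirichletCharacter ℂ N) (M : ℕ) [NeZero M]

/-- **At the cusps `γ∞` with `M ∣ c` the constant term of `F ∣_k γ` vanishes**,
`F = E - M^{1-k}(E ∣_k α_M) = E - E(M·)` (`gcd(M, N) = 1`): Billerey–Menares §3.2,
`a_0(F_2 ∣_k γ) = Υ(γ,1)(1 - (r/M)^k(χ₁χ̄₂)(M/r))` with `r = M`, `χ₁ = 𝟙`.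
[cite: BillereyMenares2018, Cor. 5 and §3.2] -/
theorem tendsto_levelRaise_slash_atImInfty_of_dvd' {E : ℍ → ℂ} {A : ℂ}
    (hE : ∀ γ : SL(2, ℤ), Tendsto (E ∣[k] γ) atImInfty
      (𝓝 (if ((γ 1 0 : ℤ) : ZMod N) = 0 then A * χ ((γ 1 1 : ℤ) : ZMod N) else 0)))
    (hMN : M.Coprime N) {γ : SL(2, ℤ)} (hγ : (M : ℤ) ∣ γ 1 0) :
    Tendsto ((E - (M : ℂ) ^ (1 - k) • (E ∣[k]
        (glCast ((diagGL (M : ℚ) 1 (Nat.cast_pos.mpr (NeZero.pos M)) one_pos : GL(2, ℚ)⁺) :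
          GL (Fin 2) ℚ)))) ∣[k] γ) atImInfty (𝓝 0) := by
  rw [sub_smul_slash_SL2]
  have h1 := hE γ
  have h2 := (tendsto_slash_diagGL_slash_atImInfty_of_dvd' χ M hE hMN hγ).const_smul
    ((M : ℂ) ^ (1 - k))
  have h := h1.sub h2
  have hM0 : (M : ℂ) ≠ 0 := by exact_mod_cast NeZero.ne M
  convert h using 2
  · simp [smul_eq_mul]
  · rw [smul_eq_mul, ← mul_assoc, ← zpow_add₀ hM0, show 1 - k + (k - 1) = 0 by ring, zpow_zero,
      one_mul, sub_self]

/-- **At the cusps `γ∞` with `gcd(c, M) = 1` the constant term of `F ∣_k γ` is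
`A χ(d)(1 - χ̄(M) M^{-k}) [N ∣ c]**, `F = E - M^{1-k}(E ∣_k α_M) = E - E(M·)` (`gcd(M, N) = 1`):
Billerey–Menares §3.2, `a_0(F_2 ∣_k γ) = Υ(γ,1)(1 - (r/M)^k(χ₁χ̄₂)(M/r))` with `r = 1`, `χ₁ = 𝟙`.
[cite: BillereyMenares2018, Cor. 5 and §3.2] -/
theorem tendsto_levelRaise_slash_atImInfty_of_isCoprime' {E : ℍ → ℂ} {A : ℂ}
    (hE : ∀ γ : SL(2, ℤ), Tendsto (E ∣[k] γ) atImInfty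
      (𝓝 (if ((γ 1 0 : ℤ) : ZMod N) = 0 then A * χ ((γ 1 1 : ℤ) : ZMod N) else 0)))
    (hMN : M.Coprime N) {γ : SL(2, ℤ)} (hγ : IsCoprime (γ 1 0) M) :
    Tendsto ((E - (M : ℂ) ^ (1 - k) • (E ∣[k]
        (glCast ((diagGL (M : ℚ) 1 (Nat.cast_pos.mpr (NeZero.pos M)) one_pos : GL(2, ℚ)⁺) :
          GL (Fin 2) ℚ)))) ∣[k] γ) atImInfty
      (𝓝 (if ((γ 1 0 : ℤ) : ZMod N) = 0 then
        A * χ ((γ 1 1 : ℤ) : ZMod N) * (1 - χ⁻¹ (M : ZMod N) * (M : ℂ) ^ (-k))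
        else 0)) := by
  rw [sub_smul_slash_SL2]
  have h1 := hE γ
  have h2 := (tendsto_slash_diagGL_slash_atImInfty_of_isCoprime' χ M hE hMN
    hγ).const_smul ((M : ℂ) ^ (1 - k))
  have h := h1.sub h2
  have hM0 : (M : ℂ) ≠ 0 := by exact_mod_cast NeZero.ne M
  convert h using 2
  · simp [smul_eq_mul]
  · split_ifs with hc
    · rw [smul_eq_mul, ← mul_assoc, ← _root_.zpow_neg_one (M : ℂ), ← zpow_add₀ hM0,
        show 1 - k + -1 = -k by ring]
      ring
    · simp

/-- **`F = E - M^{1-k}(E ∣_k α_M)` has nebentypus `χ` on `Γ₀(NM)`** if `E` has nebentypus `χ` on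
`Γ₀(N)`: `F ∣_k γ = χ(d) F` for `γ = (a b; c d) ∈ Γ₀(NM)` (`diag(M,1) γ = γ' diag(M,1)` with
`γ' = (a, Mb; c/M, d) ∈ Γ₀(N)`). [cite: BillereyMenares2018, §3.2; DiamondShurman2005, §5.6] -/
theorem levelRaise_slash_of_mem_gamma0 {E : ℍ → ℂ}
    (hE : ∀ γ : SL(2, ℤ), γ ∈ Gamma0 N → E ∣[k] γ = χ ((γ 1 1 : ℤ) : ZMod N) • E)
    {γ : SL(2, ℤ)} (hγ : γ ∈ Gamma0 (N * M)) :
    (E - (M : ℂ) ^ (1 - k) • (E ∣[k]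
        (glCast ((diagGL (M : ℚ) 1 (Nat.cast_pos.mpr (NeZero.pos M)) one_pos : GL(2, ℚ)⁺) :
          GL (Fin 2) ℚ)))) ∣[k] γ =
      χ ((γ 1 1 : ℤ) : ZMod N) • (E - (M : ℂ) ^ (1 - k) • (E ∣[k]
        (glCast ((diagGL (M : ℚ) 1 (Nat.cast_pos.mpr (NeZero.pos M)) one_pos : GL(2, ℚ)⁺) :
          GL (Fin 2) ℚ)))) := by
  have hNMc : ((N : ℤ) * M) ∣ γ 1 0 := by
    have h := hγ
    rw [Gamma0_mem, ZMod.intCast_zmod_eq_zero_iff_dvd] at h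
    exact_mod_cast h
  have hγN : γ ∈ Gamma0 N := by
    rw [Gamma0_mem, ZMod.intCast_zmod_eq_zero_iff_dvd]
    exact (dvd_mul_right _ _).trans hNMc
  -- `M ∣ c`
  have hMc : (M : ℤ) ∣ γ 1 0 := (dvd_mul_left _ _).trans hNMc
  obtain ⟨c₁, hc₁⟩ := hMc
  have hdet : (!![γ 0 0, γ 0 1; (M : ℤ) * c₁, γ 1 1]).det = 1 := by
    rw [← hc₁, Matrix.det_fin_two_of]
    have := Matrix.SpecialLinearGroup.det_coe γ
    rw [Matrix.det_fin_two] at this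
    linear_combination this
  have hdet' : (!![γ 0 0, (M : ℤ) * γ 0 1; c₁, γ 1 1]).det = 1 := by
    rw [Matrix.det_fin_two_of] at hdet ⊢
    linear_combination hdet
  have hγeq : γ = (⟨!![γ 0 0, γ 0 1; (M : ℤ) * c₁, γ 1 1], hdet⟩ : SL(2, ℤ)) := by
    ext i j
    fin_cases i <;> fin_cases j <;> simp [hc₁]
  set γ' : SL(2, ℤ) := ⟨!![γ 0 0, (M : ℤ) * γ 0 1; c₁, γ 1 1], hdet'⟩ with hγ'
  have hγ'N : γ' ∈ Gamma0 N := by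
    rw [Gamma0_mem]
    simp only [hγ']
    have hNM : ((N : ℤ) * M) ∣ (M : ℤ) * c₁ := hc₁ ▸ hNMc
    have hN : (N : ℤ) ∣ c₁ := by
      have hM0 : (M : ℤ) ≠ 0 := by exact_mod_cast NeZero.ne M
      rw [mul_comm] at hNM
      exact (mul_dvd_mul_iff_left hM0).1 hNM
    simpa [ZMod.intCast_zmod_eq_zero_iff_dvd] using hN
  have hprod := glCast_diagGL_mul_mapGL_of_dvd M (γ 0 0) (γ 0 1) c₁ (γ 1 1) hdet hdet'
  rw [← hγeq] at hprod
  have hE1 := hE γ hγN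
  have hE' := hE γ' hγ'N
  have hd : ((γ' 1 1 : ℤ) : ZMod N) = ((γ 1 1 : ℤ) : ZMod N) := by simp [hγ']
  rw [hd] at hE'
  -- slash of the `diag(M,1)`-term
  have hslash : (E ∣[k] glCast ((diagGL ((M : ℕ) : ℚ) 1
      (Nat.cast_pos.mpr (NeZero.pos M)) one_pos : GL(2, ℚ)⁺) : GL (Fin 2) ℚ)) ∣[k] γ =
      χ ((γ 1 1 : ℤ) : ZMod N) • (E ∣[k] glCast ((diagGL ((M : ℕ) : ℚ) 1
        (Nat.cast_pos.mpr (NeZero.pos M)) one_pos : GL(2, ℚ)⁺) : GL (Fin 2) ℚ)) := by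
    have hmul : (E ∣[k] glCast ((diagGL ((M : ℕ) : ℚ) 1
        (Nat.cast_pos.mpr (NeZero.pos M)) one_pos : GL(2, ℚ)⁺) : GL (Fin 2) ℚ)) ∣[k] γ =
        (E ∣[k] γ') ∣[k] glCast ((diagGL ((M : ℕ) : ℚ) 1
          (Nat.cast_pos.mpr (NeZero.pos M)) one_pos : GL(2, ℚ)⁺) : GL (Fin 2) ℚ) := by
      rw [ModularForm.SL_slash, ModularForm.SL_slash, ← SlashAction.slash_mul,
        ← SlashAction.slash_mul]
      congr 1
    rw [hmul, hE', ModularForm.smul_slash, σ_glCast]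
  rw [sub_smul_slash_SL2, hE1, hslash, smul_comm _ (χ _), ← smul_sub]

/-- For a prime `M ≠ p` coprime to `N`, an `ι`-integral `A` and `χ(M) M^k ≡ 1 (mod 𝔪)`:
**all constant terms of `F = E - M^{1-k}(E ∣_k α_M)` vanish modulo `𝔪`** — for every
`γ ∈ SL₂(ℤ)`, `F ∣_k γ → c_γ` with `v(ι⁻¹ c_γ) < 1` ("`ν_𝔭(a_0(F_2 ∣_k γ)) > 0` … using the
assumption `η(M)M^k = 1`", Billerey–Menares §3.2). [cite: BillereyMenares2018, §3.2 (proof of Thm. 2, ⟸)] -/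
theorem exists_tendsto_levelRaise_slash_valuation_lt_one [NeZero N] {p : ℕ} [Fact p.Prime]
    (ι : PadicAlgCl p ≃+* ℂ) {E : ℍ → ℂ} {A : ℂ}
    (hE : ∀ γ : SL(2, ℤ), Tendsto (E ∣[k] γ) atImInfty
      (𝓝 (if ((γ 1 0 : ℤ) : ZMod N) = 0 then A * χ ((γ 1 1 : ℤ) : ZMod N) else 0)))
    (hA : Valued.v (ι.symm A) ≤ 1) (hM : M.Prime) (hMp : M ≠ p) (hMN : M.Coprime N)
    (hcong : Valued.v (ι.symm ((χ (M : ZMod N) : ℂ) * (M : ℂ) ^ k) - 1) < 1)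
    (γ : SL(2, ℤ)) :
    ∃ c : ℂ, Tendsto ((E - (M : ℂ) ^ (1 - k) • (E ∣[k]
        (glCast ((diagGL (M : ℚ) 1 (Nat.cast_pos.mpr (NeZero.pos M)) one_pos : GL(2, ℚ)⁺) :
          GL (Fin 2) ℚ)))) ∣[k] γ) atImInfty (𝓝 c) ∧ Valued.v (ι.symm c) < 1 := by
  rcases dvd_or_isCoprime_of_prime hM (γ 1 0) with hdvd | hcop
  · exact ⟨0, tendsto_levelRaise_slash_atImInfty_of_dvd' χ M hE hMN hdvd,
      by rw [map_zero, Valuation.map_zero]; exact zero_lt_one⟩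
  · refine ⟨_, tendsto_levelRaise_slash_atImInfty_of_isCoprime' χ M hE hMN hcop, ?_⟩
    split_ifs with hc
    · -- the factor `1 - χ̄(M) M^{-k} = (χ̄(M) M^{-k}) (χ(M) M^k - 1)`
      have hMunit : IsUnit ((M : ZMod N)) := (ZMod.isUnit_iff_coprime M N).2 hMN
      have hχM : χ⁻¹ (M : ZMod N) * χ (M : ZMod N) = 1 := by
        rw [← MulChar.mul_apply, inv_mul_cancel, MulChar.one_apply hMunit]
      have hM0 : (M : ℂ) ≠ 0 := by exact_mod_cast hM.ne_zero
      have hfac : (1 - χ⁻¹ (M : ZMod N) * (M : ℂ) ^ (-k)) =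
          (χ⁻¹ (M : ZMod N) * (M : ℂ) ^ (-k)) * (χ (M : ZMod N) * (M : ℂ) ^ k - 1) := by
        have : χ⁻¹ (M : ZMod N) * (M : ℂ) ^ (-k) * (χ (M : ZMod N) * (M : ℂ) ^ k) = 1 := by
          calc _ = (χ⁻¹ (M : ZMod N) * χ (M : ZMod N)) * ((M : ℂ) ^ (-k) * (M : ℂ) ^ k) := by
                ring
            _ = 1 := by rw [hχM, ← zpow_add₀ hM0, neg_add_cancel, zpow_zero, mul_one]
        linear_combination -this
      have hv1 : Valued.v (ι.symm (A * χ ((γ 1 1 : ℤ) : ZMod N))) ≤ 1 := by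
        rw [map_mul, Valuation.map_mul]
        exact mul_le_one' hA (valuation_ringEquiv_symm_apply_le_one χ ι _)
      have hMv : Valued.v ((M : PadicAlgCl p)) = 1 := by
        rw [PadicAlgCl.valuation_def, ← map_natCast (algebraMap ℚ_[p] (PadicAlgCl p)) M]
        change (‖((M : ℚ_[p]) : PadicAlgCl p)‖₊ : ℝ≥0) = 1
        rw [← NNReal.coe_inj, coe_nnnorm, NNReal.coe_one, PadicAlgCl.norm_extends,
          Padic.norm_natCast_eq_one_iff]
        exact (Nat.coprime_primes Fact.out hM).2 hMp.symm
      have hv2 : Valued.v (ι.symm (χ⁻¹ (M : ZMod N) * (M : ℂ) ^ (-k))) ≤ 1 := by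
        have h1 : Valued.v (ι.symm (χ⁻¹ (M : ZMod N))) ≤ 1 :=
          valuation_ringEquiv_symm_apply_le_one χ⁻¹ ι _
        have h2 : Valued.v (ι.symm ((M : ℂ) ^ (-k))) = 1 := by
          rw [map_zpow₀, map_natCast ι.symm, map_zpow₀, hMv, _root_.one_zpow]
        rw [map_mul, Valuation.map_mul, h2, mul_one]
        exact h1
      have hv3 : Valued.v (ι.symm (χ (M : ZMod N) * (M : ℂ) ^ k - 1)) < 1 := by
        rw [map_sub, map_one]; exact hcong
      have hX : A * χ ((γ 1 1 : ℤ) : ZMod N) * (1 - χ⁻¹ (M : ZMod N) * (M : ℂ) ^ (-k)) =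
          (A * χ ((γ 1 1 : ℤ) : ZMod N)) * (χ⁻¹ (M : ZMod N) * (M : ℂ) ^ (-k)) *
            (χ (M : ZMod N) * (M : ℂ) ^ k - 1) := by
        rw [hfac]; simp only [mul_assoc]
      rw [hX, map_mul ι.symm, map_mul ι.symm, Valuation.map_mul, Valuation.map_mul]
      calc _ ≤ 1 * 1 * Valued.v (ι.symm (χ (M : ZMod N) * (M : ℂ) ^ k - 1)) :=
            mul_le_mul' (mul_le_mul' hv1 hv2) le_rfl
        _ < 1 := by rw [one_mul, one_mul]; exact hv3
    · rw [map_zero, Valuation.map_zero]; exact zero_lt_one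

end LevelRaise

/-! ### `F` as a modular form on `Γ₁(NM)` and its `q`-expansion -/

section Form

variable {N : ℕ} [NeZero N] {k : ℤ} (M : ℕ) [NeZero M]

/-- `(1 : ℝ)` is a strict period of `Γ₁(L)` (private copy of
`HeckeTGamma1.one_mem_strictPeriods_Gamma1`). [folklore] -/
private theorem one_mem_strictPeriods_gamma1'' (L : ℕ) :
    (1 : ℝ) ∈ (Gamma1 L : Subgroup (GL (Fin 2) ℝ)).strictPeriods := by simp

/-- The level change `[Γ₁(N) 1 Γ₁(NM)]` is the identity on functions. [cite: DiamondShurman2005, §5.1 (forms of level Γ are forms of every smaller level)] -/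
theorem coe_heckeCorrespondence_one_modularForm (E : ModularForm (Gamma1 N) k) :
    (⇑(heckeCorrespondence (Gamma1 N) (Gamma1 (N * M)) k
        (diagGL ((1 : ℕ) : ℚ) 1 (Nat.cast_pos.mpr Nat.one_pos) one_pos : GL (Fin 2) ℚ) E) :
          ℍ → ℂ) = ⇑E := by
  rw [coe_heckeCorrespondence_eq_sum _ _ k _
    (isDoubleCosetDecomp_diagGL_gamma1 (M := N) (N := N * M) Nat.one_pos (by simp))]
  simp only [univ_unique, sum_singleton, glCast_diagGL_one_one, SlashAction.slash_one]

/-- The degeneracy correspondence `[Γ₁(N) diag(M,1) Γ₁(NM)]` is the single slash `[diag(M,1)]_k`.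
[cite: DiamondShurman2005, §5.6 p. 209] -/
theorem coe_heckeCorrespondence_diagGL_modularForm (E : ModularForm (Gamma1 N) k) :
    (⇑(heckeCorrespondence (Gamma1 N) (Gamma1 (N * M)) k
        (diagGL ((M : ℕ) : ℚ) 1 (Nat.cast_pos.mpr (NeZero.pos M)) one_pos : GL (Fin 2) ℚ) E) :
          ℍ → ℂ) =
      ⇑E ∣[k] glCast ((diagGL ((M : ℕ) : ℚ) 1
        (Nat.cast_pos.mpr (NeZero.pos M)) one_pos : GL(2, ℚ)⁺) : GL (Fin 2) ℚ) := by
  rw [coe_heckeCorrespondence_eq_sum _ _ k _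
    (isDoubleCosetDecomp_diagGL_gamma1 (M := N) (N := N * M) (NeZero.pos M) dvd_rfl)]
  simp

/-- **`q`-expansion of the degeneracy slash** `[diag(M,1)]_k E = M^{k-1} E(M·)`:
`a_n = M^{k-1} [M ∣ n] a_{n/M}(E)` (Diamond–Shurman §5.7, p. 211, `ι_M`). [cite: DiamondShurman2005, §5.7 p. 211] -/
theorem qExpansion_coeff_heckeCorrespondence_diagGL_modularForm (E : ModularForm (Gamma1 N) k)
    (n : ℕ) :
    (qExpansion 1 ⇑(heckeCorrespondence (Gamma1 N) (Gamma1 (N * M)) k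
        (diagGL ((M : ℕ) : ℚ) 1 (Nat.cast_pos.mpr (NeZero.pos M)) one_pos : GL (Fin 2) ℚ)
          E)).coeff n =
      (M : ℂ) ^ (k - 1) * (if M ∣ n then (qExpansion 1 ⇑E).coeff (n / M) else 0) := by
  have hd : 0 < M := NeZero.pos M
  have hd0 : (M : ℂ) ≠ 0 := Nat.cast_ne_zero.mpr hd.ne'
  set F := heckeCorrespondence (Gamma1 N) (Gamma1 (N * M)) k
    (diagGL ((M : ℕ) : ℚ) 1 (Nat.cast_pos.mpr (NeZero.pos M)) one_pos : GL (Fin 2) ℚ) E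
    with hF_def
  -- `F τ = M^{k-1} E(Mτ)`
  have hFτ : ∀ τ : ℍ, F τ = (M : ℂ) ^ (k - 1) *
      E ⟨(M : ℂ) * τ, by simpa using mul_pos (Nat.cast_pos.mpr hd) τ.2⟩ := fun τ ↦ by
    have h1 := smul_slash_diagGL_apply k M hd ⇑E τ
    rw [← coe_heckeCorrespondence_diagGL_modularForm M E, Pi.smul_apply, smul_eq_mul] at h1
    have h2 : ((⟨(M : ℝ), Nat.cast_pos.mpr hd⟩ : {x : ℝ // 0 < x}) • τ : ℍ) =
        ⟨(M : ℂ) * τ, by simpa using mul_pos (Nat.cast_pos.mpr hd) τ.2⟩ := by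
      apply UpperHalfPlane.ext
      simp [UpperHalfPlane.coe_pos_real_smul]
    rw [h2] at h1
    rw [← h1, ← mul_assoc, ← zpow_add₀ hd0, show k - 1 + (1 - k) = 0 by ring, zpow_zero,
      one_mul]
  symm
  refine ModularFormClass.qExpansion_coeff_unique one_pos (one_mem_strictPeriods_gamma1'' (N * M))
    (f := F) (c := fun m ↦ (M : ℂ) ^ (k - 1) *
      (if M ∣ m then (qExpansion 1 ⇑E).coeff (m / M) else 0)) (fun τ ↦ ?_) n
  set τ' : ℍ := ⟨(M : ℂ) * τ, by simpa using mul_pos (Nat.cast_pos.mpr hd) τ.2⟩ with hτ'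
  have hg := hasSum_qExpansion_of_mem_strictPeriods one_pos (one_mem_strictPeriods_gamma1'' N) E τ'
  have hq : Function.Periodic.qParam 1 (τ' : ℂ) = Function.Periodic.qParam 1 τ ^ M :=
    qParam_one_natMul M τ
  rw [hq] at hg
  rw [hFτ τ]
  have hg' := hg.mul_left ((M : ℂ) ^ (k - 1))
  refine ((mul_right_injective₀ hd.ne').hasSum_iff ?_).mp ?_
  · intro m hm
    have : ¬ M ∣ m := by
      rintro ⟨j, rfl⟩
      exact hm ⟨j, rfl⟩
    simp [this]
  · have hfun : ((fun m ↦ ((M : ℂ) ^ (k - 1) *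
        (if M ∣ m then (qExpansion 1 ⇑E).coeff (m / M) else 0)) •
          Function.Periodic.qParam 1 τ ^ m) ∘ fun x ↦ M * x) =
        fun i ↦ (M : ℂ) ^ (k - 1) *
          ((qExpansion 1 ⇑E).coeff i • (Function.Periodic.qParam 1 τ ^ M) ^ i) := by
      funext m
      simp only [Function.comp_apply, smul_eq_mul]
      rw [if_pos (dvd_mul_right M m), Nat.mul_div_cancel_left m hd, pow_mul, mul_assoc]
    rw [hfun]
    exact hg'

/-- **The level-raised form**: for `E ∈ M_k(Γ₁(N))` and `M ≥ 1` there is a modular form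
`F ∈ M_k(Γ₁(NM))` — namely `[Γ₁(N) 1 Γ₁(NM)] E - M^{1-k} [Γ₁(N) diag(M,1) Γ₁(NM)] E` — with
`F = E - M^{1-k}(E ∣_k diag(M,1)) = E - E(M·)` as functions and
`a_n(F) = a_n(E) - [M ∣ n] a_{n/M}(E)`. [cite: BillereyMenares2018, §3.2 (`F₂ = E - α_M E`); DiamondShurman2005, §5.7 p. 211] -/
theorem exists_levelRaised_modularForm (E : ModularForm (Gamma1 N) k) :
    ∃ F : ModularForm (Gamma1 (N * M)) k,
      (⇑F : ℍ → ℂ) = ⇑E - ((M : ℂ) ^ (1 - k)) • (⇑E ∣[k] glCast ((diagGL ((M : ℕ) : ℚ) 1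
          (Nat.cast_pos.mpr (NeZero.pos M)) one_pos : GL(2, ℚ)⁺) : GL (Fin 2) ℚ)) ∧
      ∀ n : ℕ, (qExpansion 1 ⇑F).coeff n =
        (qExpansion 1 ⇑E).coeff n - (if M ∣ n then (qExpansion 1 ⇑E).coeff (n / M) else 0) := by
  have hd0 : (M : ℂ) ≠ 0 := Nat.cast_ne_zero.mpr (NeZero.pos M).ne'
  have h1 := one_mem_strictPeriods_gamma1'' (N * M)
  refine ⟨heckeCorrespondence (Gamma1 N) (Gamma1 (N * M)) k
      (diagGL ((1 : ℕ) : ℚ) 1 (Nat.cast_pos.mpr Nat.one_pos) one_pos : GL (Fin 2) ℚ) E -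
    ((M : ℂ) ^ (1 - k)) • heckeCorrespondence (Gamma1 N) (Gamma1 (N * M)) k
      (diagGL ((M : ℕ) : ℚ) 1 (Nat.cast_pos.mpr (NeZero.pos M)) one_pos : GL (Fin 2) ℚ) E,
    ?_, fun n ↦ ?_⟩
  · rw [ModularForm.coe_sub, IsGLPos.coe_smul, coe_heckeCorrespondence_one_modularForm,
      coe_heckeCorrespondence_diagGL_modularForm]
  · rw [ModularForm.coe_sub, ModularForm.qExpansion_sub one_pos h1, map_sub,
      IsGLPos.coe_smul, ModularForm.qExpansion_smul one_pos h1, map_smul,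
      coe_heckeCorrespondence_one_modularForm, qExpansion_coeff_heckeCorrespondence_diagGL_modularForm,
      smul_eq_mul, ← mul_assoc, ← zpow_add₀ hd0, show 1 - k + (k - 1) = 0 by ring, zpow_zero,
      one_mul]

end Form

end Literature.NumberTheory.EllipticCurves.ModularForms
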